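import Summits.AtomisticToContinuum.HydrodynamicLimit.Theorems.LambertianContactSwapLambertianWellPosedRestart

/-!
# Truncated forward regularity of the Lambertian hard-sphere recursion

Helper file (`--supports`) of the support item `LambertianWellPosed` of route `LambertianContactSwap`
(`AtomisticToContinuum/HydrodynamicLimit`, stmt-AtomisticToContinuum-12101); continuation of
`…LambertianWellPosedRestart`. The three clauses of forward regularity up to a horizon `T` of the
Lambertian recursion — simple incoming exits at the instants `≤ T`, no grazing touch inside the free
flights before `T`, some instant beyond `T` (the Lambertian copy of `Alexander.FwdGoodUpTo`) — are written
inline; they give collision segments (`exists_lambert_segment`), keep the flow in the domain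
(`lambertFlow_mem_of_segment`), are ADDITIVE under restart with the shifted noise
(`lambert_fwdGoodUpTo_add`, port of `Alexander.FwdGoodUpTo.add`), and at every integer horizon imply the
three untruncated clauses of the route item (`lambert_fwdGood_of_forall`).
-/

noncomputable section

open MeasureTheory Set Function Filter
open scoped ENNReal

namespace Summit.AtomisticToContinuum.HydrodynamicLimit.Theorems

open Literature.MathematicalPhysics.KineticTheory Literature.Analysis.FluidPDE
  Literature.Analysis.FluidPDE.Alexander

namespace LRestart

variable {d : Type*} [Fintype d] {X : Type*} {N : ℕ} {G : Geometry d X} {ε : ℝ}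
  {ξs : ℕ → EuclideanSpace ℝ d} {z : Config N d X} {s : ℝ} {k : ℕ}

/-! ## Truncated forward regularity of the Lambertian recursion

The three clauses "simple incoming exits at the instants `≤ T`", "no grazing touch inside the free flights
before `T`", "some instant beyond `T`" (the Lambertian copy of `Alexander.FwdGoodUpTo`) are written inline. -/

/-- Up to the horizon every time lies in a collision segment: if some instant exceeds `T` then for
`s ≤ T` there is `k` with `t_k ≤ s < t_{k+1}`. [folklore] -/
theorem exists_lambert_segment {T : ℝ} (h3 : ∃ k, ENNReal.ofReal T < lambertInstant G ε ξs z k) {s : ℝ}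
    (hs : s ≤ T) :
    ∃ k, lambertInstant G ε ξs z k ≤ ENNReal.ofReal s ∧ ENNReal.ofReal s < lambertInstant G ε ξs z (k + 1) := by
  classical
  obtain ⟨k0, hk0⟩ := h3
  have hex : ∃ m, ENNReal.ofReal s < lambertInstant G ε ξs z m :=
    ⟨k0, (ENNReal.ofReal_le_ofReal hs).trans_lt hk0⟩
  have hm0 : Nat.find hex ≠ 0 := by
    intro h0
    have := Nat.find_spec hex
    rw [h0, lambertInstant_zero] at this
    exact ENNReal.not_lt_zero this
  obtain ⟨k, hk⟩ := Nat.exists_eq_add_one_of_ne_zero hm0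
  refine ⟨k, ?_, by rw [← hk]; exact Nat.find_spec hex⟩
  have := Nat.find_min hex (m := k) (by omega)
  exact not_lt.1 this

/-- The Lambertian flow stays in the hard-sphere domain up to the horizon of truncated regularity (on
every collision segment, by definition of the exit time). [folklore] -/
theorem lambertFlow_mem_of_segment {T : ℝ} (h3 : ∃ k, ENNReal.ofReal T < lambertInstant G ε ξs z k)
    {s : ℝ} (hs0 : 0 ≤ s) (hs : s ≤ T) : lambertFlow G ε ξs z s ∈ hardSphereDomain G N ε := by
  obtain ⟨k, h1, h2⟩ := exists_lambert_segment h3 hs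
  have h2' := h2
  rw [lambertInstant_succ] at h2'
  obtain ⟨-, hle, hlt, -⟩ := segment_arith' hs0 h1 h2'
  rw [lambertFlow_eq_of_segment h1 h2]
  exact freeFlight_mem_hardSphereDomain_of_lt (sub_nonneg.2 hle) hlt

/-- **Restart of truncated regularity of the Lambertian recursion**: if `(z, ξs)` is forward regular up
to time `s` and the restarted pair `(Λ_s(z; ξs), ξs (· + K_s))`, `K_s = lambertCount`, is forward regular up
to time `u`, then `(z, ξs)` is forward regular up to time `s + u`, and
`Λ_{s+u}(z; ξs) = Λ_u(Λ_s(z; ξs); ξs (· + K_s))`. [folklore] -/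
theorem lambert_fwdGoodUpTo_add {u : ℝ} (hs : 0 ≤ s) (hu : 0 ≤ u)
    (hz1 : ∀ k, lambertInstant G ε ξs z (k + 1) ≤ ENNReal.ofReal s →
      IsSimpleIncoming G ε (freeFlight G (freeExitTime G ε (lambertStateAfter G ε ξs z k)).toReal
        (lambertStateAfter G ε ξs z k)))
    (hz2 : ∀ k (t : ℝ), 0 < t → ENNReal.ofReal t < freeExitTime G ε (lambertStateAfter G ε ξs z k) →
      lambertInstant G ε ξs z k + ENNReal.ofReal t ≤ ENNReal.ofReal s →
      ∀ i j : Fin N, i ≠ j → freeFlight G t (lambertStateAfter G ε ξs z k) ∉ contactSet G N ε i j)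
    (hz3 : ∃ k, ENNReal.ofReal s < lambertInstant G ε ξs z k)
    (hw1 : ∀ m, lambertInstant G ε (fun n => ξs (n + lambertCount G ε ξs z s)) (lambertFlow G ε ξs z s) (m + 1) ≤
        ENNReal.ofReal u →
      IsSimpleIncoming G ε (freeFlight G (freeExitTime G ε
        (lambertStateAfter G ε (fun n => ξs (n + lambertCount G ε ξs z s)) (lambertFlow G ε ξs z s) m)).toReal
          (lambertStateAfter G ε (fun n => ξs (n + lambertCount G ε ξs z s)) (lambertFlow G ε ξs z s) m)))
    (hw2 : ∀ m (t : ℝ), 0 < t → ENNReal.ofReal t < freeExitTime G ε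
        (lambertStateAfter G ε (fun n => ξs (n + lambertCount G ε ξs z s)) (lambertFlow G ε ξs z s) m) →
      lambertInstant G ε (fun n => ξs (n + lambertCount G ε ξs z s)) (lambertFlow G ε ξs z s) m + ENNReal.ofReal t ≤
        ENNReal.ofReal u →
      ∀ i j : Fin N, i ≠ j → freeFlight G t
        (lambertStateAfter G ε (fun n => ξs (n + lambertCount G ε ξs z s)) (lambertFlow G ε ξs z s) m) ∉
          contactSet G N ε i j)
    (hw3 : ∃ m, ENNReal.ofReal u <
      lambertInstant G ε (fun n => ξs (n + lambertCount G ε ξs z s)) (lambertFlow G ε ξs z s) m) :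
    (∀ k, lambertInstant G ε ξs z (k + 1) ≤ ENNReal.ofReal (s + u) →
      IsSimpleIncoming G ε (freeFlight G (freeExitTime G ε (lambertStateAfter G ε ξs z k)).toReal
        (lambertStateAfter G ε ξs z k))) ∧
    (∀ k (t : ℝ), 0 < t → ENNReal.ofReal t < freeExitTime G ε (lambertStateAfter G ε ξs z k) →
      lambertInstant G ε ξs z k + ENNReal.ofReal t ≤ ENNReal.ofReal (s + u) →
      ∀ i j : Fin N, i ≠ j → freeFlight G t (lambertStateAfter G ε ξs z k) ∉ contactSet G N ε i j) ∧
    (∃ k, ENNReal.ofReal (s + u) < lambertInstant G ε ξs z k) ∧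
    lambertFlow G ε ξs z (s + u) =
      lambertFlow G ε (fun n => ξs (n + lambertCount G ε ξs z s)) (lambertFlow G ε ξs z s) u := by
  obtain ⟨k, h1, h2⟩ := exists_lambert_segment hz3 le_rfl
  have hK : lambertCount G ε ξs z s = k := lambertCount_eq_of_segment h1 h2
  rw [hK] at hw1 hw2 hw3 ⊢
  have h2' := h2
  rw [lambertInstant_succ] at h2'
  obtain ⟨hfin, hle, hlt, hsplit⟩ := segment_arith' hs h1 h2'
  set w := lambertFlow G ε ξs z s with hw_def
  set η : ℕ → EuclideanSpace ℝ d := fun n => ξs (n + k) with hη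
  have hweq : w = freeFlight G (s - (lambertInstant G ε ξs z k).toReal) (lambertStateAfter G ε ξs z k) :=
    lambertFlow_eq_of_segment h1 h2
  have hsu : ENNReal.ofReal (s + u) = ENNReal.ofReal u + ENNReal.ofReal s := by
    rw [add_comm, ENNReal.ofReal_add hu hs]
  have hshift : freeExitTime G ε w + ENNReal.ofReal (s - (lambertInstant G ε ξs z k).toReal) =
      freeExitTime G ε (lambertStateAfter G ε ξs z k) := by
    rw [hweq]; exact freeExitTime_freeFlight_add (sub_nonneg.2 hle) hlt.le
  have hinst : ∀ m, lambertInstant G ε η w (m + 1) + ENNReal.ofReal s = lambertInstant G ε ξs z (k + (m + 1)) :=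
    fun m => lambertInstant_lambertFlow_succ_add hs h1 h2 m
  -- instants beyond `s` force `τ(z_k) < ∞`
  have hτ_of_le : ∀ {m : ℕ} {c : ℝ≥0∞}, c ≠ ∞ → lambertInstant G ε ξs z (k + (m + 1)) ≤ c →
      freeExitTime G ε (lambertStateAfter G ε ξs z k) ≠ ∞ := by
    intro m c hc hmc htop
    have : lambertInstant G ε ξs z (k + (m + 1)) = ∞ := by
      refine top_unique ?_
      calc (⊤ : ℝ≥0∞) = lambertInstant G ε ξs z (k + 1) := by rw [lambertInstant_succ, htop, add_top]
        _ ≤ _ := monotone_lambertInstant _ _ (by omega)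
    rw [this] at hmc
    exact hc (top_unique hmc)
  -- an index `k'` whose segment reaches beyond `s` is `≥ k`
  have hk_le : ∀ {k' : ℕ}, ENNReal.ofReal s < lambertInstant G ε ξs z (k' + 1) → k ≤ k' := by
    intro k' hk'
    by_contra hlt'
    have : lambertInstant G ε ξs z (k' + 1) ≤ lambertInstant G ε ξs z k := monotone_lambertInstant _ _ (by omega)
    exact (not_le.2 hk') (this.trans h1)
  refine ⟨fun k' hk' => ?_, fun k' t ht htk hkt i j hij => ?_, ?_,
    hw3.elim fun m hm => (exists_lambert_segment ⟨m, hm⟩ le_rfl).elim fun m' hm' =>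
      lambertFlow_add_of_segment hs hu h1 h2 hm'.1 hm'.2⟩
  · -- (i) simple incoming exits up to time `s + u`
    by_cases hcase : lambertInstant G ε ξs z (k' + 1) ≤ ENNReal.ofReal s
    · exact hz1 k' hcase
    obtain ⟨m, rfl⟩ := Nat.exists_eq_add_of_le (hk_le (not_le.1 hcase))
    rw [Nat.add_assoc] at hk'
    have hτ : freeExitTime G ε (lambertStateAfter G ε ξs z k) ≠ ∞ := hτ_of_le ENNReal.ofReal_ne_top hk'
    have hwm : lambertInstant G ε η w (m + 1) ≤ ENNReal.ofReal u := by
      rw [hsu, ← hinst m] at hk'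
      exact (ENNReal.add_le_add_iff_right ENNReal.ofReal_ne_top).1 hk'
    have key := hw1 m hwm
    rcases Nat.eq_zero_or_pos m with rfl | hmpos
    · -- the current free flight of `z_k`, seen from `w`
      rw [lambertStateAfter_zero, hweq, freeFlight_freeExitTime_freeFlight (sub_nonneg.2 hle) hlt.le hτ] at key
      simpa only [add_zero] using key
    · obtain ⟨m, rfl⟩ := Nat.exists_eq_add_one_of_ne_zero hmpos.ne'
      rwa [lambertStateAfter_lambertFlow_succ hs h1 h2 hτ m] at key
  · -- (ii) no touch inside the free flights up to time `s + u`
    by_cases hcase : lambertInstant G ε ξs z k' + ENNReal.ofReal t ≤ ENNReal.ofReal s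
    · exact hz2 k' t ht htk hcase i j hij
    have hfin' : lambertInstant G ε ξs z k' ≠ ∞ := by
      intro htop; rw [htop, top_add] at hkt; exact ENNReal.ofReal_ne_top (top_unique hkt)
    have hk' : k ≤ k' := by
      refine hk_le (lt_of_lt_of_le (not_le.1 hcase) ?_)
      rw [lambertInstant_succ]
      exact add_le_add le_rfl htk.le
    obtain ⟨m, rfl⟩ := Nat.exists_eq_add_of_le hk'
    rcases Nat.eq_zero_or_pos m with rfl | hmpos
    · -- inside the current free flight of `z_k`: time `t - (s - t_k)` after `w`
      simp only [add_zero] at htk hkt hcase ⊢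
      have hta : s - (lambertInstant G ε ξs z k).toReal < t := by
        by_contra hle'
        push Not at hle'
        apply hcase
        calc lambertInstant G ε ξs z k + ENNReal.ofReal t
            ≤ lambertInstant G ε ξs z k + ENNReal.ofReal (s - (lambertInstant G ε ξs z k).toReal) := by gcongr
          _ = ENNReal.ofReal s := hsplit
      have heq : freeFlight G t (lambertStateAfter G ε ξs z k) =
          freeFlight G (t - (s - (lambertInstant G ε ξs z k).toReal)) w := by
        rw [hweq, ← freeFlight_add, sub_add_cancel]
      rw [heq]
      refine hw2 0 (t - (s - (lambertInstant G ε ξs z k).toReal)) (sub_pos.2 hta) ?_ ?_ i j hij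
      · rw [lambertStateAfter_zero]
        have : ENNReal.ofReal t = ENNReal.ofReal (t - (s - (lambertInstant G ε ξs z k).toReal)) +
            ENNReal.ofReal (s - (lambertInstant G ε ξs z k).toReal) := by
          rw [← ENNReal.ofReal_add (sub_pos.2 hta).le (sub_nonneg.2 hle), sub_add_cancel]
        rw [← hshift, this] at htk
        exact (ENNReal.add_lt_add_iff_right ENNReal.ofReal_ne_top).1 htk
      · rw [lambertInstant_zero, zero_add]
        refine ENNReal.ofReal_le_ofReal ?_
        have h3 : (lambertInstant G ε ξs z k).toReal + t ≤ s + u := by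
          have := hkt
          rw [← ENNReal.ofReal_toReal hfin, ← ENNReal.ofReal_add ENNReal.toReal_nonneg ht.le] at this
          exact (ENNReal.ofReal_le_ofReal_iff (by linarith)).1 this
        linarith
    · obtain ⟨m, rfl⟩ := Nat.exists_eq_add_one_of_ne_zero hmpos.ne'
      have hτ : freeExitTime G ε (lambertStateAfter G ε ξs z k) ≠ ∞ :=
        hτ_of_le (c := ENNReal.ofReal (s + u)) ENNReal.ofReal_ne_top ((le_add_right le_rfl).trans hkt)
      rw [← lambertStateAfter_lambertFlow_succ hs h1 h2 hτ m] at htk ⊢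
      refine hw2 (m + 1) t ht htk ?_ i j hij
      rw [hsu, ← hinst m, add_right_comm] at hkt
      exact (ENNReal.add_le_add_iff_right ENNReal.ofReal_ne_top).1 hkt
  · -- (iii) an instant beyond `s + u`
    obtain ⟨m, hm⟩ := hw3
    have hm0 : m ≠ 0 := by
      rintro rfl
      rw [lambertInstant_zero] at hm
      exact ENNReal.not_lt_zero hm
    obtain ⟨m, rfl⟩ := Nat.exists_eq_add_one_of_ne_zero hm0
    refine ⟨k + (m + 1), ?_⟩
    rw [hsu, ← hinst m]
    exact ENNReal.add_lt_add_right ENNReal.ofReal_ne_top hm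

/-- **Truncated regularity at every integer horizon gives the three untruncated clauses** of the route
item (every finite exit configuration is simple incoming, no touch strictly inside a free flight, and the
exit times are not summable). [folklore] -/
theorem lambert_fwdGood_of_forall
    (h : ∀ T : ℕ, (∀ k, lambertInstant G ε ξs z (k + 1) ≤ ENNReal.ofReal T →
        IsSimpleIncoming G ε (freeFlight G (freeExitTime G ε (lambertStateAfter G ε ξs z k)).toReal
          (lambertStateAfter G ε ξs z k))) ∧
      (∀ k (t : ℝ), 0 < t → ENNReal.ofReal t < freeExitTime G ε (lambertStateAfter G ε ξs z k) →
        lambertInstant G ε ξs z k + ENNReal.ofReal t ≤ ENNReal.ofReal T →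
        ∀ i j : Fin N, i ≠ j → freeFlight G t (lambertStateAfter G ε ξs z k) ∉ contactSet G N ε i j) ∧
      (∃ k, ENNReal.ofReal T < lambertInstant G ε ξs z k)) :
    (∀ k, freeExitTime G ε (lambertStateAfter G ε ξs z k) ≠ ⊤ →
        IsSimpleIncoming G ε (freeFlight G (freeExitTime G ε (lambertStateAfter G ε ξs z k)).toReal
          (lambertStateAfter G ε ξs z k))) ∧
    (∀ k (t : ℝ), 0 < t → ENNReal.ofReal t < freeExitTime G ε (lambertStateAfter G ε ξs z k) →
        ∀ i j : Fin N, i ≠ j → freeFlight G t (lambertStateAfter G ε ξs z k) ∉ contactSet G N ε i j) ∧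
    ∑' k, freeExitTime G ε (lambertStateAfter G ε ξs z k) = ⊤ := by
  refine ⟨fun k hk => ?_, fun k t ht htk i j hij => ?_, ?_⟩
  · -- (i): the instant `t_{k+1}` is finite, pick an integer horizon beyond it
    have hfin : lambertInstant G ε ξs z (k + 1) ≠ ∞ := by
      rw [lambertInstant_ne_top_iff]
      intro m hm htop
      have heq := lambertStateAfter_eq_of_top htop (Nat.le_of_lt_succ hm)
      rw [heq] at hk
      exact hk htop
    obtain ⟨n, hn⟩ := exists_nat_ge (lambertInstant G ε ξs z (k + 1)).toReal
    refine (h n).1 k ?_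
    rw [← ENNReal.ofReal_toReal hfin]
    exact ENNReal.ofReal_le_ofReal hn
  · -- (ii): reduce to a reachable index
    obtain ⟨m, -, hm, heq⟩ := exists_lambertStateAfter_eq_reachable (G := G) (ε := ε) ξs z k
    rw [heq] at htk ⊢
    have hfin : lambertInstant G ε ξs z m + ENNReal.ofReal t ≠ ∞ :=
      ENNReal.add_ne_top.2 ⟨hm, ENNReal.ofReal_ne_top⟩
    obtain ⟨n, hn⟩ := exists_nat_ge (lambertInstant G ε ξs z m + ENNReal.ofReal t).toReal
    refine (h n).2.1 m t ht htk ?_ i j hij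
    rw [← ENNReal.ofReal_toReal hfin]
    exact ENNReal.ofReal_le_ofReal hn
  · -- (iii): the instants are unbounded, so the exit times are not summable
    by_contra hne
    have hlt : ∑' k, freeExitTime G ε (lambertStateAfter G ε ξs z k) < ∞ := lt_top_iff_ne_top.2 hne
    obtain ⟨n, hn⟩ := exists_nat_gt (∑' k, freeExitTime G ε (lambertStateAfter G ε ξs z k)).toReal
    obtain ⟨k, hk⟩ := (h n).2.2
    have hle : lambertInstant G ε ξs z k ≤ ∑' k, freeExitTime G ε (lambertStateAfter G ε ξs z k) :=
      ENNReal.sum_le_tsum _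
    have : ENNReal.ofReal n < ∑' k, freeExitTime G ε (lambertStateAfter G ε ξs z k) := hk.trans_le hle
    rw [← ENNReal.ofReal_toReal hne, ENNReal.ofReal_lt_ofReal_iff_of_nonneg (Nat.cast_nonneg n)] at this
    exact lt_asymm this hn

/-- **Restart, the count**: `K_{s+u}(z; ξs) = k + K_u(Λ_s(z; ξs); ξs (· + k))` when `s` lies in the `k`-th
collision segment of `z` and `u` in a collision segment of the restarted recursion. [folklore] -/
theorem lambertCount_add_of_segment (hs : 0 ≤ s) {u : ℝ} (hu : 0 ≤ u)
    (h1 : lambertInstant G ε ξs z k ≤ ENNReal.ofReal s)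
    (h2 : ENNReal.ofReal s < lambertInstant G ε ξs z (k + 1)) {m : ℕ}
    (h1' : lambertInstant G ε (fun n => ξs (n + k)) (lambertFlow G ε ξs z s) m ≤ ENNReal.ofReal u)
    (h2' : ENNReal.ofReal u < lambertInstant G ε (fun n => ξs (n + k)) (lambertFlow G ε ξs z s) (m + 1)) :
    lambertCount G ε ξs z (s + u) = k + m := by
  have hsu : ENNReal.ofReal (s + u) = ENNReal.ofReal u + ENNReal.ofReal s := by
    rw [add_comm, ENNReal.ofReal_add hu hs]
  rcases Nat.eq_zero_or_pos m with rfl | hm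
  · have hA : lambertInstant G ε ξs z k ≤ ENNReal.ofReal (s + u) :=
      h1.trans (ENNReal.ofReal_le_ofReal (by linarith))
    have hB : ENNReal.ofReal (s + u) < lambertInstant G ε ξs z (k + 1) := by
      rw [hsu, ← lambertInstant_lambertFlow_succ_add hs h1 h2 0]
      exact ENNReal.add_lt_add_right ENNReal.ofReal_ne_top h2'
    rw [add_zero]
    exact lambertCount_eq_of_segment hA hB
  · obtain ⟨m, rfl⟩ := Nat.exists_eq_add_one_of_ne_zero hm.ne'
    have hA : lambertInstant G ε ξs z (k + (m + 1)) ≤ ENNReal.ofReal (s + u) := by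
      rw [hsu, ← lambertInstant_lambertFlow_succ_add hs h1 h2 m]
      exact add_le_add h1' le_rfl
    have hB : ENNReal.ofReal (s + u) < lambertInstant G ε ξs z (k + (m + 1) + 1) := by
      rw [hsu, show k + (m + 1) + 1 = k + (m + 1 + 1) by omega,
        ← lambertInstant_lambertFlow_succ_add hs h1 h2 (m + 1)]
      exact ENNReal.add_lt_add_right ENNReal.ofReal_ne_top h2'
    exact lambertCount_eq_of_segment hA hB

end LRestart

end Summit.AtomisticToContinuum.HydrodynamicLimit.Theorems
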